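import Summits.Ventures.Crystal3D.Theorems.StickyWulffConstantTextureLiminfFluxPolyline
import Summits.Ventures.Crystal3D.Theorems.StickyWulffConstantNoReconstructionGainCubicActions
import HarnessLib

/-!
# Presentation normalisation of an fcc plate: every kissing direction is an upper slot of SOME frame of the same lattice
# (lane T, crux `TextureLiminfV5`, stmt-Ventures-23912; cf-p1 DECISION (cii)/(cii′) work item (S), 2026-08-29T04:06:50Z/04:09:13Z)

HONEST FRAMING. Venture `Summits/Ventures/Crystal3D` (cell `crystal3d-full`), route `route-Ventures-StickyWulffConstant`, helper
`--supports` the law-v5 crux `TextureLiminfV5` (stmt-Ventures-23912).  Lattice geometry only, standard axioms; nothing about any wall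
law is claimed; rung F-C1 not moved.

WHY ((δ)-fcc of the EDGE-ON memo).  An unfaulted plate `stacking A s constHagg = A·Λ₀ + s` has one presentation per frame of `Λ₀`; the
one-sided walker ledger K1a (canonical or chosen slot) wants its family slot among the three UPPER slots `upSlot₁₂₃` of the presenting frame.
This file shows that EVERY one of the twelve kissing vectors `w ∈ fccSlots` is `g v` for an upper slot `v` and a lattice isometry `g` of
`Λ₀` (`g = id` for the three upper slots, `g = −id` for the three lower ones, `g =` the bond mirror `(ℝ∙m)ᗮ.reflection` at another upper
slot `m` for the six in-plane ones — `latticeIsometry_bondReflection`, `fcc_neg_mem`), hence: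
* `stacking_trans_of_mapsTo_fcc` — re-framing by a lattice isometry does not change the plate: `stacking (g.trans A) s constHagg =
  stacking A s constHagg`;
* **`exists_fcc_presentation_of_slot`** — for every frame `A`, origin `s` and kissing vector `w ∈ fccSlots` there is a frame `L′` of the
  SAME plate (`stacking L′ s constHagg = stacking A s constHagg`) and an upper slot `v ∈ {upSlot₁, upSlot₂, upSlot₃}` with `L′ v = A w`.
So «the fcc plate has a kissing direction `w` with `⟪A w, ν⟫ ≥ 13√2/25`» (the presentation-free criterion of (cii′)) upgrades to «some
presentation of the plate has an upper slot rising `≥ 13√2/25` toward `ν`», which is the steepness input of `barlow_hlines_oriented_oneSided_at`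
(with `upFrame`) and of 19480-p2's `FluxFeasible`.  The table re-indexing (M) is a separate item.
WHAT THIS IS NOT: no statement about walls; F-C1 not moved.
-/

noncomputable section

namespace Summit.Ventures.Crystal3D.Theorems

open Summit.Ventures.Crystal3D
open Literature.MathematicalPhysics.StatisticalMechanics (barlowPos barlowStacking fccStacking constHagg haggLabel haggLabel_const
  haggLabel_zero triangularVec₁ triangularVec₂ barlowOffset layerNormal)
open Summit.Ventures.Crystal3D.Cruxes.TextureLiminf.TexShadow (E3 stacking upSlot₁ upSlot₂ upSlot₃)
open scoped InnerProductSpace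

/-! ## Re-framing by a lattice isometry -/

/-- **Re-framing an fcc plate by a lattice isometry of `Λ₀` does not change it**: if `g` and `g⁻¹` map `Λ₀` into itself then
`stacking (g.trans A) s constHagg = stacking A s constHagg`. -/
theorem stacking_trans_of_mapsTo_fcc (g A : E3 ≃ₗᵢ[ℝ] E3) (s : E3)
    (h₁ : ∀ p ∈ fccStacking 1 (Real.sqrt (2 / 3)), g p ∈ fccStacking 1 (Real.sqrt (2 / 3)))
    (h₂ : ∀ p ∈ fccStacking 1 (Real.sqrt (2 / 3)), g.symm p ∈ fccStacking 1 (Real.sqrt (2 / 3))) :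
    stacking (g.trans A) s constHagg = stacking A s constHagg := by
  have hfcc : barlowStacking 1 (Real.sqrt (2 / 3)) constHagg = fccStacking 1 (Real.sqrt (2 / 3)) := rfl
  ext p
  simp only [stacking, hfcc, Set.mem_image, LinearIsometryEquiv.coe_trans, Function.comp_apply]
  constructor
  · rintro ⟨r, hr, rfl⟩
    exact ⟨g r, h₁ r hr, rfl⟩
  · rintro ⟨r, hr, rfl⟩
    exact ⟨g.symm r, h₂ r hr, by rw [LinearIsometryEquiv.apply_symm_apply]⟩

/-- Re-framing by the central inversion `−id` (a lattice isometry of `Λ₀`). -/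
theorem stacking_neg_trans (A : E3 ≃ₗᵢ[ℝ] E3) (s : E3) :
    stacking ((LinearIsometryEquiv.neg ℝ).trans A) s constHagg = stacking A s constHagg :=
  stacking_trans_of_mapsTo_fcc _ A s (fun _ hp => fcc_neg_mem hp) (fun _ hp => fcc_neg_mem hp)

/-- Re-framing by the bond mirror at a kissing vector `m` (a lattice isometry of `Λ₀`, `latticeIsometry_bondReflection`). -/
theorem stacking_bondReflection_trans (A : E3 ≃ₗᵢ[ℝ] E3) (s : E3) {m : E3} (hm : m ∈ fccSlots) :
    stacking (((ℝ ∙ m)ᗮ.reflection).trans A) s constHagg = stacking A s constHagg :=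
  have h := latticeIsometry_bondReflection (mem_fcc_of_mem_fccSlots hm) (norm_eq_one_of_mem_fccSlots hm)
  stacking_trans_of_mapsTo_fcc _ A s h.1 h.2

/-! ## The twelve kissing vectors from the three upper slots -/

/-- Differences of upper slots are the in-plane slots: `barlowPos 1 i j − barlowPos 1 i' j' = barlowPos 0 (i−i') (j−j')` (fcc labels). -/
theorem barlowPos_one_sub_one (i j i' j' : ℤ) :
    barlowPos 1 (Real.sqrt (2 / 3)) constHagg 1 i j - barlowPos 1 (Real.sqrt (2 / 3)) constHagg 1 i' j' =
      barlowPos 1 (Real.sqrt (2 / 3)) constHagg 0 (i - i') (j - j') := by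
  simp only [barlowPos, haggLabel_const]
  push_cast
  module

/-- The lower slots are the negatives of the upper ones: `−barlowPos 1 i j = barlowPos (−1) (−i) (−j)` (fcc labels). -/
theorem neg_barlowPos_one (i j : ℤ) :
    -barlowPos 1 (Real.sqrt (2 / 3)) constHagg 1 i j = barlowPos 1 (Real.sqrt (2 / 3)) constHagg (-1) (-i) (-j) := by
  simp only [barlowPos, haggLabel_const]
  push_cast
  module

/-- An in-plane site `barlowPos 0 i j` with `(0, i, j) ∈ fccSlotTriples` is a slot. -/
theorem barlowPos_zero_mem_fccSlots {i j : ℤ} (h : ((0 : ℤ), i, j) ∈ fccSlotTriples) :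
    barlowPos 1 (Real.sqrt (2 / 3)) constHagg 0 i j ∈ fccSlots := by
  classical
  rw [fccSlots, Finset.mem_image]
  exact ⟨(0, i, j), h, rfl⟩

/-- Two unit vectors at distance `1` have inner product `½`. -/
theorem inner_eq_half_of_unit_dist {v m : E3} (hv : ‖v‖ = 1) (hm : ‖m‖ = 1) (hd : ‖v - m‖ = 1) : ⟪m, v⟫_ℝ = 1 / 2 := by
  have h := norm_sub_sq_real v m
  rw [hd, hv, hm, real_inner_comm] at h
  linarith

/-- **In-plane case.**  If `v` and `m` are slots with `‖v − m‖ = 1` then the bond mirror at `m`, followed by `A`, is a frame of the same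
plate sending `v` to `A (v − m)`. -/
theorem exists_presentation_sub (A : E3 ≃ₗᵢ[ℝ] E3) (s : E3) {v m : E3} (hv : v ∈ fccSlots) (hm : m ∈ fccSlots)
    (hd : ‖v - m‖ = 1) :
    ∃ L' : E3 ≃ₗᵢ[ℝ] E3, stacking L' s constHagg = stacking A s constHagg ∧ L' v = A (v - m) := by
  refine ⟨((ℝ ∙ m)ᗮ.reflection).trans A, stacking_bondReflection_trans A s hm, ?_⟩
  have hmn := norm_eq_one_of_mem_fccSlots hm
  rw [LinearIsometryEquiv.coe_trans, Function.comp_apply, bondReflection_apply m v hmn,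
    inner_eq_half_of_unit_dist (norm_eq_one_of_mem_fccSlots hv) hmn hd]
  norm_num

/-- **Lower-slot case.**  `−id` followed by `A` is a frame of the same plate sending `v` to `A (−v)`. -/
theorem exists_presentation_neg (A : E3 ≃ₗᵢ[ℝ] E3) (s : E3) (v : E3) :
    ∃ L' : E3 ≃ₗᵢ[ℝ] E3, stacking L' s constHagg = stacking A s constHagg ∧ L' v = A (-v) :=
  ⟨(LinearIsometryEquiv.neg ℝ).trans A, stacking_neg_trans A s, by simp⟩

/-- **Every kissing vector is an upper slot of some frame of the same fcc plate.**  For every frame `A`, origin `s` and `w ∈ fccSlots`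
there is a frame `L′` with `stacking L′ s constHagg = stacking A s constHagg` and an upper slot `v ∈ {upSlot₁, upSlot₂, upSlot₃}` with
`L′ v = A w` (so the plate presented by `L′` has the kissing direction `A w` as the Δ-slot `v`: `⟪L′ v, ν⟫ = ⟪A w, ν⟫` for every `ν`). -/
theorem exists_fcc_presentation_of_slot (A : E3 ≃ₗᵢ[ℝ] E3) (s : E3) {w : E3} (hw : w ∈ fccSlots) :
    ∃ L' : E3 ≃ₗᵢ[ℝ] E3, stacking L' s constHagg = stacking A s constHagg ∧
      ∃ v : E3, (v = upSlot₁ ∨ v = upSlot₂ ∨ v = upSlot₃) ∧ L' v = A w := by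
  classical
  obtain ⟨hu₁, hu₂, hu₃⟩ := upSlots_mem_fccSlots
  -- the six in-plane slots as differences of upper slots, and their norms
  have d12 : upSlot₁ - upSlot₂ = barlowPos 1 (Real.sqrt (2 / 3)) constHagg 0 1 0 := by
    rw [upSlot₁, upSlot₂, barlowPos_one_sub_one]; norm_num
  have d13 : upSlot₁ - upSlot₃ = barlowPos 1 (Real.sqrt (2 / 3)) constHagg 0 0 1 := by
    rw [upSlot₁, upSlot₃, barlowPos_one_sub_one]; norm_num
  have d32 : upSlot₃ - upSlot₂ = barlowPos 1 (Real.sqrt (2 / 3)) constHagg 0 1 (-1) := by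
    rw [upSlot₃, upSlot₂, barlowPos_one_sub_one]; norm_num
  have d21 : upSlot₂ - upSlot₁ = barlowPos 1 (Real.sqrt (2 / 3)) constHagg 0 (-1) 0 := by
    rw [upSlot₂, upSlot₁, barlowPos_one_sub_one]; norm_num
  have d31 : upSlot₃ - upSlot₁ = barlowPos 1 (Real.sqrt (2 / 3)) constHagg 0 0 (-1) := by
    rw [upSlot₃, upSlot₁, barlowPos_one_sub_one]; norm_num
  have d23 : upSlot₂ - upSlot₃ = barlowPos 1 (Real.sqrt (2 / 3)) constHagg 0 (-1) 1 := by
    rw [upSlot₂, upSlot₃, barlowPos_one_sub_one]; norm_num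
  have n12 : ‖upSlot₁ - upSlot₂‖ = 1 := by
    rw [d12]; exact norm_eq_one_of_mem_fccSlots (barlowPos_zero_mem_fccSlots (by simp [fccSlotTriples]))
  have n13 : ‖upSlot₁ - upSlot₃‖ = 1 := by
    rw [d13]; exact norm_eq_one_of_mem_fccSlots (barlowPos_zero_mem_fccSlots (by simp [fccSlotTriples]))
  have n32 : ‖upSlot₃ - upSlot₂‖ = 1 := by
    rw [d32]; exact norm_eq_one_of_mem_fccSlots (barlowPos_zero_mem_fccSlots (by simp [fccSlotTriples]))
  have n21 : ‖upSlot₂ - upSlot₁‖ = 1 := by rw [norm_sub_rev]; exact n12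
  have n31 : ‖upSlot₃ - upSlot₁‖ = 1 := by rw [norm_sub_rev]; exact n13
  have n23 : ‖upSlot₂ - upSlot₃‖ = 1 := by rw [norm_sub_rev]; exact n32
  -- the three lower slots as negatives of upper slots
  have m1 : -upSlot₁ = barlowPos 1 (Real.sqrt (2 / 3)) constHagg (-1) 0 0 := by
    rw [upSlot₁, neg_barlowPos_one]; norm_num
  have m2 : -upSlot₂ = barlowPos 1 (Real.sqrt (2 / 3)) constHagg (-1) 1 0 := by
    rw [upSlot₂, neg_barlowPos_one]; norm_num
  have m3 : -upSlot₃ = barlowPos 1 (Real.sqrt (2 / 3)) constHagg (-1) 0 1 := by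
    rw [upSlot₃, neg_barlowPos_one]; norm_num
  -- case analysis over the twelve triples
  rw [fccSlots, Finset.mem_image] at hw
  obtain ⟨c, hc, rfl⟩ := hw
  simp only [fccSlotTriples, Finset.mem_insert, Finset.mem_singleton] at hc
  rcases hc with rfl | rfl | rfl | rfl | rfl | rfl | rfl | rfl | rfl | rfl | rfl | rfl <;> dsimp only
  · -- (0, 1, 0) = upSlot₁ − upSlot₂
    obtain ⟨L', h1, h2⟩ := exists_presentation_sub A s hu₁ hu₂ n12
    exact ⟨L', h1, upSlot₁, Or.inl rfl, by rw [h2, d12]⟩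
  · -- (0, 0, 1) = upSlot₁ − upSlot₃
    obtain ⟨L', h1, h2⟩ := exists_presentation_sub A s hu₁ hu₃ n13
    exact ⟨L', h1, upSlot₁, Or.inl rfl, by rw [h2, d13]⟩
  · -- (1, 0, 0) = upSlot₁
    exact ⟨A, rfl, upSlot₁, Or.inl rfl, rfl⟩
  · -- (0, 1, −1) = upSlot₃ − upSlot₂
    obtain ⟨L', h1, h2⟩ := exists_presentation_sub A s hu₃ hu₂ n32
    exact ⟨L', h1, upSlot₃, Or.inr (Or.inr rfl), by rw [h2, d32]⟩
  · -- (−1, 1, 0) = −upSlot₂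
    obtain ⟨L', h1, h2⟩ := exists_presentation_neg A s upSlot₂
    exact ⟨L', h1, upSlot₂, Or.inr (Or.inl rfl), by rw [h2, m2]⟩
  · -- (−1, 0, 1) = −upSlot₃
    obtain ⟨L', h1, h2⟩ := exists_presentation_neg A s upSlot₃
    exact ⟨L', h1, upSlot₃, Or.inr (Or.inr rfl), by rw [h2, m3]⟩
  · -- (0, −1, 0) = upSlot₂ − upSlot₁
    obtain ⟨L', h1, h2⟩ := exists_presentation_sub A s hu₂ hu₁ n21
    exact ⟨L', h1, upSlot₂, Or.inr (Or.inl rfl), by rw [h2, d21]⟩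
  · -- (0, 0, −1) = upSlot₃ − upSlot₁
    obtain ⟨L', h1, h2⟩ := exists_presentation_sub A s hu₃ hu₁ n31
    exact ⟨L', h1, upSlot₃, Or.inr (Or.inr rfl), by rw [h2, d31]⟩
  · -- (−1, 0, 0) = −upSlot₁
    obtain ⟨L', h1, h2⟩ := exists_presentation_neg A s upSlot₁
    exact ⟨L', h1, upSlot₁, Or.inl rfl, by rw [h2, m1]⟩
  · -- (0, −1, 1) = upSlot₂ − upSlot₃
    obtain ⟨L', h1, h2⟩ := exists_presentation_sub A s hu₂ hu₃ n23
    exact ⟨L', h1, upSlot₂, Or.inr (Or.inl rfl), by rw [h2, d23]⟩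
  · -- (1, −1, 0) = upSlot₂
    exact ⟨A, rfl, upSlot₂, Or.inr (Or.inl rfl), rfl⟩
  · -- (1, 0, −1) = upSlot₃
    exact ⟨A, rfl, upSlot₃, Or.inr (Or.inr rfl), rfl⟩

/-- The upper slots are slots of height `√(2/3)` (the `hv`, `hv2` inputs of `barlow_hlines_oriented_oneSided_at`). -/
theorem upSlot_cases_mem {v : E3} (h : v = upSlot₁ ∨ v = upSlot₂ ∨ v = upSlot₃) :
    v ∈ fccSlots ∧ v 2 = Real.sqrt (2 / 3) := by
  obtain ⟨hu₁, hu₂, hu₃⟩ := upSlots_mem_fccSlots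
  rcases h with rfl | rfl | rfl
  · exact ⟨hu₁, by simp [upSlot₁]⟩
  · exact ⟨hu₂, by simp [upSlot₂]⟩
  · exact ⟨hu₃, by simp [upSlot₃]⟩

/-- **Presentation normalisation, user form.**  If some kissing direction of the fcc plate `(A, s)` rises at least `τ` toward `e`, then some
frame `L′` of the SAME plate has an upper slot `v ∈ fccSlots`, `v₂ = √(2/3)`, with `τ ≤ ⟪L′ v, e⟫` — the steepness input of the chosen-slot
walker ledger for that presentation. -/
theorem exists_fcc_presentation_steep (A : E3 ≃ₗᵢ[ℝ] E3) (s e : E3) (τ : ℝ)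
    (h : ∃ w ∈ fccSlots, τ ≤ ⟪A w, e⟫_ℝ) :
    ∃ L' : E3 ≃ₗᵢ[ℝ] E3, stacking L' s constHagg = stacking A s constHagg ∧
      ∃ v ∈ fccSlots, v 2 = Real.sqrt (2 / 3) ∧ τ ≤ ⟪L' v, e⟫_ℝ := by
  obtain ⟨w, hw, hτ⟩ := h
  obtain ⟨L', hL', v, hv, hLv⟩ := exists_fcc_presentation_of_slot A s hw
  obtain ⟨hv1, hv2⟩ := upSlot_cases_mem hv
  exact ⟨L', hL', v, hv1, hv2, by rw [hLv]; exact hτ⟩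

end Summit.Ventures.Crystal3D.Theorems

end
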